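import Mathlib.Analysis.Calculus.IteratedDeriv.Lemmas
import Mathlib.Analysis.Calculus.ContDiff.Deriv
import HarnessLib

/-!
# Iterated-derivative bounds for quadratic nearest-neighbour chains (shell models)

Topic `Literature/Analysis/ODE` (namespace `Literature.Analysis.ODE`). Quantitative companion of
`NearestNeighbourChainSmooth.lean` for the QUADRATIC nearest-neighbour chains of shell-model type
`x_j' = -a_j(t) x_j + ε_j x_{j-1} x_j - δ_j x_{j+1}²` (`j ∈ ℕ`; Obukhov / Desnyansky–Novikov /
dyadic models after rescaling, `a_j` = a time-dependent damping, `ε_0 = 0` encodes `x_{-1} ≡ 0`).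
This is the step "differentiating the system shows that time derivatives of `x_k` grow at most
polynomially in the local amplitudes `(A_{k+i})_{i≤j}` and frequencies `(N_{k+i})_{i≤j}` … all
bounded terms are weighted by the small factor" of S. Palasek, arXiv:2605.13827, §3.3 (proof of
Thm 1.3, smoothness of the force), made explicit:

* `abs_iteratedDerivWithin_le_of_quadraticChain` — if `|x_j| ≤ G_j⁰` and
  `|a_j^{(i)}| ≤ α_{j,i}` on `[a, b]`, then `|x_j^{(n)}| ≤ G_j^n` on `[a, b]` for ANY family
  `G` dominating the Leibniz recursion
  `Σ_{i≤n} C(n,i) (α_{j,i} G_j^{n-i} + |ε_j| G_{j-1}^i G_j^{n-i} + |δ_j| G_{j+1}^i G_{j+1}^{n-i}) ≤ G_j^{n+1}`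
  (a "supersolution" of the bound recursion; the user instantiates it with explicit polynomial
  bounds in his parameters);
* `abs_iteratedDerivWithin_le_mul_of_quadraticChain` — SMALL-FACTOR version: if moreover the
  modes `l ≥ k` are small on an initial segment `t ≤ s`, `|x_l(t)| ≤ θ G_l⁰`, then all their
  derivatives inherit the factor: `|x_l^{(n)}(t)| ≤ θ G_l^n` for `l ≥ k`, `t ≤ s` (every monomial
  produced by differentiating the equation of a mode `l ≥ k` keeps an undifferentiated factor
  `x_{l'}` with `l' ≥ l`).

Derivatives are `iteratedDerivWithin _ _ (Icc a b)` (one-sided at the endpoints), the equation is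
assumed in `derivWithin` form on `[a, b]`, `a < b`, for `C^∞` data (see
`contDiffOn_of_nearestNeighbourChain` for the smoothness). Mathlib's Leibniz formula
`iteratedDerivWithin_mul` does the work. All proved, no definitions, no named facts.

## References

* S. Palasek, *Finite-time blow-up in an elementary model of the 3D Navier–Stokes equations*,
  arXiv:2605.13827 (2026), §3.3, proof of Thm 1.3 (force estimate, higher derivatives).
  Key `Palasek2026ElementaryModel`.
-/

noncomputable section

open Set Finset
open scoped ContDiff

namespace Literature.Analysis.ODE

section QuadraticChain

variable {x a : ℕ → ℝ → ℝ} {δ ε : ℕ → ℝ} {t₀ t₁ : ℝ} {α G : ℕ → ℕ → ℝ}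

/-- Triangle/Leibniz bookkeeping: `|Σ C(n,i) u_i v_{n-i}| ≤ Σ C(n,i) U_i V_{n-i}` when
`|u_i| ≤ U_i`, `|v_i| ≤ V_i` (all `i ≤ n`). [folklore] -/
private theorem abs_sum_choose_mul_le {n : ℕ} {u v : ℕ → ℝ} {U V : ℕ → ℝ}
    (hu : ∀ i ≤ n, |u i| ≤ U i) (hv : ∀ i ≤ n, |v i| ≤ V i) :
    |∑ i ∈ range (n + 1), (n.choose i : ℝ) * u i * v (n - i)| ≤
      ∑ i ∈ range (n + 1), (n.choose i : ℝ) * U i * V (n - i) := by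
  refine (abs_sum_le_sum_abs _ _).trans (sum_le_sum fun i hi => ?_)
  have hi' : i ≤ n := Nat.lt_succ_iff.1 (mem_range.1 hi)
  rw [abs_mul, abs_mul, Nat.abs_cast]
  have hU : 0 ≤ U i := (abs_nonneg _).trans (hu i hi')
  exact mul_le_mul (mul_le_mul_of_nonneg_left (hu i hi') (Nat.cast_nonneg _)) (hv _ (Nat.sub_le _ _))
    (abs_nonneg _) (mul_nonneg (Nat.cast_nonneg _) hU)

/-- The Leibniz expansion of the `n`-th derivative of the quadratic right-hand side. [folklore] -/
private theorem iteratedDerivWithin_rhs (ht₀ : t₀ < t₁) (hx : ∀ j, ContDiffOn ℝ ∞ (x j) (Icc t₀ t₁))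
    (ha : ∀ j, ContDiffOn ℝ ∞ (a j) (Icc t₀ t₁)) (j n : ℕ) {t : ℝ} (ht : t ∈ Icc t₀ t₁) :
    iteratedDerivWithin n
        (fun s => -a j s * x j s + ε j * x (j - 1) s * x j s - δ j * x (j + 1) s ^ 2) (Icc t₀ t₁) t =
      -(∑ i ∈ range (n + 1), (n.choose i : ℝ) * iteratedDerivWithin i (a j) (Icc t₀ t₁) t *
          iteratedDerivWithin (n - i) (x j) (Icc t₀ t₁) t) +
      (ε j * ∑ i ∈ range (n + 1), (n.choose i : ℝ) * iteratedDerivWithin i (x (j - 1)) (Icc t₀ t₁) t *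
          iteratedDerivWithin (n - i) (x j) (Icc t₀ t₁) t -
        δ j * ∑ i ∈ range (n + 1), (n.choose i : ℝ) * iteratedDerivWithin i (x (j + 1)) (Icc t₀ t₁) t *
          iteratedDerivWithin (n - i) (x (j + 1)) (Icc t₀ t₁) t) := by
  have hI : UniqueDiffOn ℝ (Icc t₀ t₁) := uniqueDiffOn_Icc ht₀
  have hxn : ∀ j, ContDiffWithinAt ℝ n (x j) (Icc t₀ t₁) t := fun j =>
    ((hx j).of_le (by exact_mod_cast le_top)) t ht
  have han : ContDiffWithinAt ℝ n (a j) (Icc t₀ t₁) t := ((ha j).of_le (by exact_mod_cast le_top)) t ht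
  have hfun : (fun s => -a j s * x j s + ε j * x (j - 1) s * x j s - δ j * x (j + 1) s ^ 2) =
      fun s => -(a j * x j) s + ((ε j * (x (j - 1) * x j) s) - δ j * (x (j + 1) * x (j + 1)) s) := by
    funext s; simp only [Pi.mul_apply]; ring
  rw [hfun]
  have hA : ContDiffWithinAt ℝ n (a j * x j) (Icc t₀ t₁) t := han.mul (hxn j)
  have hB : ContDiffWithinAt ℝ n (x (j - 1) * x j) (Icc t₀ t₁) t := (hxn _).mul (hxn j)
  have hC : ContDiffWithinAt ℝ n (x (j + 1) * x (j + 1)) (Icc t₀ t₁) t := (hxn _).mul (hxn _)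
  have hB' : ContDiffWithinAt ℝ n (fun s => ε j * (x (j - 1) * x j) s) (Icc t₀ t₁) t :=
    contDiffWithinAt_const.mul hB
  have hC' : ContDiffWithinAt ℝ n (fun s => δ j * (x (j + 1) * x (j + 1)) s) (Icc t₀ t₁) t :=
    contDiffWithinAt_const.mul hC
  rw [iteratedDerivWithin_fun_add ht hI hA.neg (hB'.sub hC'), iteratedDerivWithin_fun_neg,
    show (fun s => ε j * (x (j - 1) * x j) s - δ j * (x (j + 1) * x (j + 1)) s) =
      ((fun s => ε j * (x (j - 1) * x j) s) - fun s => δ j * (x (j + 1) * x (j + 1)) s) from rfl,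
    iteratedDerivWithin_sub ht hI hB' hC', iteratedDerivWithin_const_mul ht hI _ hB,
    iteratedDerivWithin_const_mul ht hI _ hC, iteratedDerivWithin_mul ht hI han (hxn j),
    iteratedDerivWithin_mul ht hI (hxn _) (hxn j), iteratedDerivWithin_mul ht hI (hxn _) (hxn _)]

/-- **Derivative bounds for a quadratic nearest-neighbour chain, with small factors.** On
`[t₀, t₁]`, `t₀ < t₁`, let `C^∞` functions `x_j`, `a_j` (`j ∈ ℕ`) satisfy
`x_j' = -a_j x_j + ε_j x_{j-1} x_j - δ_j x_{j+1}²` (derivative within the interval; for `j = 0` read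
`x_{0-1} = x_0`, harmless when `ε_0 = 0`), with `|a_j^{(i)}| ≤ α_{j,i}` and `|x_j| ≤ G_j⁰` there, and
let `G` dominate the Leibniz recursion (`hG`). Suppose the modes `l ≥ k` carry a small factor on
the initial segment `t ≤ s`: `|x_l(t)| ≤ θ G_l⁰`. Then for every order `n ≤ M` (the recursion being assumed below `M`): `|x_j^{(n)}| ≤ G_j^n` on
the whole interval for every `j`, and `|x_l^{(n)}(t)| ≤ θ G_l^n` for `l ≥ k`, `t ≤ s`.
[cite: Palasek2026ElementaryModel, §3.3 proof of Thm 1.3 (higher derivatives of the force)] -/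
theorem abs_iteratedDerivWithin_le_mul_of_quadraticChain (ht₀ : t₀ < t₁)
    (hx : ∀ j, ContDiffOn ℝ ∞ (x j) (Icc t₀ t₁)) (ha : ∀ j, ContDiffOn ℝ ∞ (a j) (Icc t₀ t₁))
    (hode : ∀ j, ∀ t ∈ Icc t₀ t₁, derivWithin (x j) (Icc t₀ t₁) t =
      -a j t * x j t + ε j * x (j - 1) t * x j t - δ j * x (j + 1) t ^ 2)
    (hα : ∀ j i, ∀ t ∈ Icc t₀ t₁, |iteratedDerivWithin i (a j) (Icc t₀ t₁) t| ≤ α j i)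
    (hG0 : ∀ j, ∀ t ∈ Icc t₀ t₁, |x j t| ≤ G j 0)
    {M : ℕ} (hG : ∀ j n, n < M → ∑ i ∈ range (n + 1), (n.choose i : ℝ) *
        (α j i * G j (n - i) + |ε j| * G (j - 1) i * G j (n - i) +
          |δ j| * G (j + 1) i * G (j + 1) (n - i)) ≤ G j (n + 1))
    {k : ℕ} {s θ : ℝ} (hθ : 0 ≤ θ)
    (hsmall : ∀ l, k ≤ l → ∀ t ∈ Icc t₀ t₁, t ≤ s → |x l t| ≤ θ * G l 0) {n : ℕ} (hn : n ≤ M) :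
    (∀ j, ∀ t ∈ Icc t₀ t₁, |iteratedDerivWithin n (x j) (Icc t₀ t₁) t| ≤ G j n) ∧
      ∀ l, k ≤ l → ∀ t ∈ Icc t₀ t₁, t ≤ s →
        |iteratedDerivWithin n (x l) (Icc t₀ t₁) t| ≤ θ * G l n := by
  have hI : UniqueDiffOn ℝ (Icc t₀ t₁) := uniqueDiffOn_Icc ht₀
  -- cumulative induction on the order
  suffices H : ∀ n, n ≤ M → (∀ m ≤ n, ∀ j, ∀ t ∈ Icc t₀ t₁,
      |iteratedDerivWithin m (x j) (Icc t₀ t₁) t| ≤ G j m) ∧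
      ∀ m ≤ n, ∀ l, k ≤ l → ∀ t ∈ Icc t₀ t₁, t ≤ s →
        |iteratedDerivWithin m (x l) (Icc t₀ t₁) t| ≤ θ * G l m from
    ⟨fun j t ht => (H n hn).1 n le_rfl j t ht, fun l hl t ht hts => (H n hn).2 n le_rfl l hl t ht hts⟩
  intro n
  induction n with
  | zero =>
    intro _
    refine ⟨fun m hm j t ht => ?_, fun m hm l hl t ht hts => ?_⟩
    · obtain rfl := Nat.le_zero.1 hm
      simpa using hG0 j t ht
    · obtain rfl := Nat.le_zero.1 hm
      simpa using hsmall l hl t ht hts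
  | succ n ih =>
    intro hnM
    have hnM' : n < M := Nat.lt_of_succ_le hnM
    obtain ⟨ihc, ihs⟩ := ih hnM'.le
    -- the `(n+1)`-st derivative through the equation
    have hstep : ∀ j, ∀ t ∈ Icc t₀ t₁, iteratedDerivWithin (n + 1) (x j) (Icc t₀ t₁) t =
        -(∑ i ∈ range (n + 1), (n.choose i : ℝ) * iteratedDerivWithin i (a j) (Icc t₀ t₁) t *
            iteratedDerivWithin (n - i) (x j) (Icc t₀ t₁) t) +
        (ε j * ∑ i ∈ range (n + 1), (n.choose i : ℝ) *
            iteratedDerivWithin i (x (j - 1)) (Icc t₀ t₁) t * iteratedDerivWithin (n - i) (x j) (Icc t₀ t₁) t -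
          δ j * ∑ i ∈ range (n + 1), (n.choose i : ℝ) *
            iteratedDerivWithin i (x (j + 1)) (Icc t₀ t₁) t *
              iteratedDerivWithin (n - i) (x (j + 1)) (Icc t₀ t₁) t) := by
      intro j t ht
      rw [iteratedDerivWithin_succ', iteratedDerivWithin_congr (hode j) ht]
      exact iteratedDerivWithin_rhs ht₀ hx ha j n ht
    -- crude bound at order `n + 1`
    have hcrude : ∀ j, ∀ t ∈ Icc t₀ t₁,
        |iteratedDerivWithin (n + 1) (x j) (Icc t₀ t₁) t| ≤ G j (n + 1) := by
      intro j t ht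
      rw [hstep j t ht]
      have h1 := abs_sum_choose_mul_le (n := n)
        (u := fun i => iteratedDerivWithin i (a j) (Icc t₀ t₁) t)
        (v := fun i => iteratedDerivWithin i (x j) (Icc t₀ t₁) t) (U := α j) (V := G j)
        (fun i _ => hα j i t ht) (fun i hi => ihc i hi j t ht)
      have h2 := abs_sum_choose_mul_le (n := n)
        (u := fun i => iteratedDerivWithin i (x (j - 1)) (Icc t₀ t₁) t)
        (v := fun i => iteratedDerivWithin i (x j) (Icc t₀ t₁) t) (U := G (j - 1)) (V := G j)
        (fun i hi => ihc i hi _ t ht) (fun i hi => ihc i hi j t ht)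
      have h3 := abs_sum_choose_mul_le (n := n)
        (u := fun i => iteratedDerivWithin i (x (j + 1)) (Icc t₀ t₁) t)
        (v := fun i => iteratedDerivWithin i (x (j + 1)) (Icc t₀ t₁) t) (U := G (j + 1)) (V := G (j + 1))
        (fun i hi => ihc i hi _ t ht) (fun i hi => ihc i hi _ t ht)
      refine le_trans ?_ (hG j n hnM')
      calc _ ≤ |∑ i ∈ range (n + 1), (n.choose i : ℝ) * iteratedDerivWithin i (a j) (Icc t₀ t₁) t *
                iteratedDerivWithin (n - i) (x j) (Icc t₀ t₁) t| +
              (|ε j| * |∑ i ∈ range (n + 1), (n.choose i : ℝ) *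
                iteratedDerivWithin i (x (j - 1)) (Icc t₀ t₁) t *
                  iteratedDerivWithin (n - i) (x j) (Icc t₀ t₁) t| +
               |δ j| * |∑ i ∈ range (n + 1), (n.choose i : ℝ) *
                iteratedDerivWithin i (x (j + 1)) (Icc t₀ t₁) t *
                  iteratedDerivWithin (n - i) (x (j + 1)) (Icc t₀ t₁) t|) := by
            refine (abs_add_le _ _).trans (add_le_add (by rw [abs_neg]) ?_)
            refine (abs_sub _ _).trans (add_le_add ?_ ?_) <;> rw [abs_mul]
        _ ≤ ∑ i ∈ range (n + 1), (n.choose i : ℝ) * α j i * G j (n - i) +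
              (|ε j| * ∑ i ∈ range (n + 1), (n.choose i : ℝ) * G (j - 1) i * G j (n - i) +
               |δ j| * ∑ i ∈ range (n + 1), (n.choose i : ℝ) * G (j + 1) i * G (j + 1) (n - i)) := by
            gcongr
        _ = _ := by
            rw [mul_sum, mul_sum, ← sum_add_distrib, ← sum_add_distrib]
            refine sum_congr rfl fun i _ => ?_
            ring
    -- small bound at order `n + 1` for the modes `l ≥ k` on `t ≤ s`
    have hsm : ∀ l, k ≤ l → ∀ t ∈ Icc t₀ t₁, t ≤ s →
        |iteratedDerivWithin (n + 1) (x l) (Icc t₀ t₁) t| ≤ θ * G l (n + 1) := by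
      intro l hl t ht hts
      rw [hstep l t ht]
      have h1 := abs_sum_choose_mul_le (n := n)
        (u := fun i => iteratedDerivWithin i (a l) (Icc t₀ t₁) t)
        (v := fun i => iteratedDerivWithin i (x l) (Icc t₀ t₁) t) (U := α l) (V := fun i => θ * G l i)
        (fun i _ => hα l i t ht) (fun i hi => ihs i hi l hl t ht hts)
      have h2 := abs_sum_choose_mul_le (n := n)
        (u := fun i => iteratedDerivWithin i (x (l - 1)) (Icc t₀ t₁) t)
        (v := fun i => iteratedDerivWithin i (x l) (Icc t₀ t₁) t) (U := G (l - 1))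
        (V := fun i => θ * G l i)
        (fun i hi => ihc i hi _ t ht) (fun i hi => ihs i hi l hl t ht hts)
      have h3 := abs_sum_choose_mul_le (n := n)
        (u := fun i => iteratedDerivWithin i (x (l + 1)) (Icc t₀ t₁) t)
        (v := fun i => iteratedDerivWithin i (x (l + 1)) (Icc t₀ t₁) t) (U := G (l + 1))
        (V := fun i => θ * G (l + 1) i)
        (fun i hi => ihc i hi _ t ht) (fun i hi => ihs i hi (l + 1) (hl.trans (Nat.le_succ l)) t ht hts)
      refine le_trans ?_ (mul_le_mul_of_nonneg_left (hG l n hnM') hθ)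
      calc _ ≤ |∑ i ∈ range (n + 1), (n.choose i : ℝ) * iteratedDerivWithin i (a l) (Icc t₀ t₁) t *
                iteratedDerivWithin (n - i) (x l) (Icc t₀ t₁) t| +
              (|ε l| * |∑ i ∈ range (n + 1), (n.choose i : ℝ) *
                iteratedDerivWithin i (x (l - 1)) (Icc t₀ t₁) t *
                  iteratedDerivWithin (n - i) (x l) (Icc t₀ t₁) t| +
               |δ l| * |∑ i ∈ range (n + 1), (n.choose i : ℝ) *
                iteratedDerivWithin i (x (l + 1)) (Icc t₀ t₁) t *
                  iteratedDerivWithin (n - i) (x (l + 1)) (Icc t₀ t₁) t|) := by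
            refine (abs_add_le _ _).trans (add_le_add (by rw [abs_neg]) ?_)
            refine (abs_sub _ _).trans (add_le_add ?_ ?_) <;> rw [abs_mul]
        _ ≤ ∑ i ∈ range (n + 1), (n.choose i : ℝ) * α l i * (θ * G l (n - i)) +
              (|ε l| * ∑ i ∈ range (n + 1), (n.choose i : ℝ) * G (l - 1) i * (θ * G l (n - i)) +
               |δ l| * ∑ i ∈ range (n + 1), (n.choose i : ℝ) * G (l + 1) i * (θ * G (l + 1) (n - i))) := by
            gcongr
        _ = θ * ∑ i ∈ range (n + 1), (n.choose i : ℝ) *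
              (α l i * G l (n - i) + |ε l| * G (l - 1) i * G l (n - i) +
                |δ l| * G (l + 1) i * G (l + 1) (n - i)) := by
            rw [mul_sum, mul_sum, mul_sum, ← sum_add_distrib, ← sum_add_distrib]
            refine sum_congr rfl fun i _ => ?_
            ring
    refine ⟨fun m hm j t ht => ?_, fun m hm l hl t ht hts => ?_⟩
    · rcases Nat.of_le_succ hm with h | h
      · exact ihc m h j t ht
      · rw [h]; exact hcrude j t ht
    · rcases Nat.of_le_succ hm with h | h
      · exact ihs m h l hl t ht hts
      · rw [h]; exact hsm l hl t ht hts

/-- **Derivative bounds for a quadratic nearest-neighbour chain** (no small factor): under the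
hypotheses of `abs_iteratedDerivWithin_le_mul_of_quadraticChain` without the smallness data,
`|x_j^{(n)}| ≤ G_j^n` on `[t₀, t₁]` for every mode `j` and order `n`.
[cite: Palasek2026ElementaryModel, §3.3 proof of Thm 1.3 ("time derivatives of x_k grow at most polynomially")] -/
theorem abs_iteratedDerivWithin_le_of_quadraticChain (ht₀ : t₀ < t₁)
    (hx : ∀ j, ContDiffOn ℝ ∞ (x j) (Icc t₀ t₁)) (ha : ∀ j, ContDiffOn ℝ ∞ (a j) (Icc t₀ t₁))
    (hode : ∀ j, ∀ t ∈ Icc t₀ t₁, derivWithin (x j) (Icc t₀ t₁) t =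
      -a j t * x j t + ε j * x (j - 1) t * x j t - δ j * x (j + 1) t ^ 2)
    (hα : ∀ j i, ∀ t ∈ Icc t₀ t₁, |iteratedDerivWithin i (a j) (Icc t₀ t₁) t| ≤ α j i)
    (hG0 : ∀ j, ∀ t ∈ Icc t₀ t₁, |x j t| ≤ G j 0)
    {M : ℕ} (hG : ∀ j n, n < M → ∑ i ∈ range (n + 1), (n.choose i : ℝ) *
        (α j i * G j (n - i) + |ε j| * G (j - 1) i * G j (n - i) +
          |δ j| * G (j + 1) i * G (j + 1) (n - i)) ≤ G j (n + 1))
    {n : ℕ} (hn : n ≤ M) (j : ℕ) {t : ℝ} (ht : t ∈ Icc t₀ t₁) :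
    |iteratedDerivWithin n (x j) (Icc t₀ t₁) t| ≤ G j n :=
  (abs_iteratedDerivWithin_le_mul_of_quadraticChain ht₀ hx ha hode hα hG0 hG (k := 0) (s := t₁)
    (θ := 1) zero_le_one (fun l _ t ht _ => by simpa using hG0 l t ht) hn).1 j t ht

/-! ### An explicit polynomial supersolution of the bound recursion -/

/-- Exponent bookkeeping: `i + 1 + 3^(n-i) ≤ 3^(n+1)` for `i ≤ n`. [folklore] -/
private theorem exp_bound₁ {n i : ℕ} (hi : i ≤ n) : i + 1 + 3 ^ (n - i) ≤ 3 ^ (n + 1) := by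
  have h1 : 3 ^ (n - i) ≤ 3 ^ n := Nat.pow_le_pow_right (by norm_num) (Nat.sub_le n i)
  have h2 : n < 3 ^ n := Nat.lt_pow_self (by norm_num)
  have h3 : 3 ^ (n + 1) = 3 * 3 ^ n := by rw [pow_succ]; ring
  omega

/-- Exponent bookkeeping: `3^i + 3^(n-i) ≤ 3^(n+1)` for `i ≤ n`. [folklore] -/
private theorem exp_bound₂ {n i : ℕ} (hi : i ≤ n) : 3 ^ i + 3 ^ (n - i) ≤ 3 ^ (n + 1) := by
  have h1 : 3 ^ (n - i) ≤ 3 ^ n := Nat.pow_le_pow_right (by norm_num) (Nat.sub_le n i)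
  have h0 : 3 ^ i ≤ 3 ^ n := Nat.pow_le_pow_right (by norm_num) hi
  have h3 : 3 ^ (n + 1) = 3 * 3 ^ n := by rw [pow_succ]; ring
  omega

/-- Monotonicity in base and exponent at once, for bases `≥ 1`. [folklore] -/
private theorem pow_le_pow_of_le_of_le {u W : ℝ} {e e' : ℕ} (hu : 1 ≤ u) (huW : u ≤ W) (he : e ≤ e') :
    u ^ e ≤ W ^ e' :=
  (pow_le_pow_left₀ (zero_le_one.trans hu) huW e).trans (pow_le_pow_right₀ (hu.trans huW) he)

/-- Factorial bookkeeping: `C(n,i) (i! (n-i)!)² ≤ (n!)²` for `i ≤ n`. [folklore] -/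
private theorem choose_mul_factorial_sq_le {n i : ℕ} (hi : i ≤ n) :
    (n.choose i : ℝ) * ((i.factorial : ℝ) * ((n - i).factorial : ℝ)) ^ 2 ≤ (n.factorial : ℝ) ^ 2 := by
  have h := Nat.choose_mul_factorial_mul_factorial hi
  have hc : 1 ≤ n.choose i := Nat.choose_pos hi
  have h' : (n.choose i : ℝ) * ((i.factorial : ℝ) * ((n - i).factorial : ℝ)) = n.factorial := by
    rw [← mul_assoc]; exact_mod_cast h
  have hle : (i.factorial : ℝ) * ((n - i).factorial : ℝ) ≤ n.factorial := by
    have : (1 : ℝ) * ((i.factorial : ℝ) * ((n - i).factorial : ℝ)) ≤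
        (n.choose i : ℝ) * ((i.factorial : ℝ) * ((n - i).factorial : ℝ)) :=
      mul_le_mul_of_nonneg_right (by exact_mod_cast hc) (by positivity)
    rw [one_mul, h'] at this
    exact this
  calc (n.choose i : ℝ) * ((i.factorial : ℝ) * ((n - i).factorial : ℝ)) ^ 2
      = ((n.choose i : ℝ) * ((i.factorial : ℝ) * ((n - i).factorial : ℝ))) *
          ((i.factorial : ℝ) * ((n - i).factorial : ℝ)) := by ring
    _ ≤ (n.factorial : ℝ) * (n.factorial : ℝ) := by
        rw [h']; exact mul_le_mul_of_nonneg_left hle (by positivity)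
    _ = (n.factorial : ℝ) ^ 2 := by ring

/-- **Explicit polynomial derivative bounds for a quadratic nearest-neighbour chain.** In the
setting of `abs_iteratedDerivWithin_le_mul_of_quadraticChain`, suppose all the data are controlled
by ONE non-decreasing scale sequence `Λ_j ≥ 1`: `|a_j^{(i)}| ≤ κ_i Λ_j^{i+1}` (with
`κ_i ≤ κ̄` for the orders `i < M` in use, `κ̄ ≥ 0`), `|ε_j| ≤ 1`, `|δ_j| ≤ 1`, `|x_j| ≤ Λ_j`, and
`|x_l(t)| ≤ θ Λ_l` for the modes `l ≥ k` on `t ≤ s`. Then for every order `n ≤ M`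
`|x_j^{(n)}(t)| ≤ (κ̄ + 2)^n (n!)² Λ_{j+n}^{3^n}` on `[t₀, t₁]`, and the modes `l ≥ k` keep the small
factor on `t ≤ s`: `|x_l^{(n)}(t)| ≤ θ (κ̄ + 2)^n (n!)² Λ_{l+n}^{3^n}` — "time derivatives of `x_k`
grow at most polynomially in the local amplitudes and frequencies `(A_{k+i}, N_{k+i})_{i ≤ n}`,
… weighted by the small factor". [cite: Palasek2026ElementaryModel, §3.3 proof of Thm 1.3 (higher derivatives of the force)] -/
theorem abs_iteratedDerivWithin_le_pow_of_quadraticChain (ht₀ : t₀ < t₁)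
    (hx : ∀ j, ContDiffOn ℝ ∞ (x j) (Icc t₀ t₁)) (ha : ∀ j, ContDiffOn ℝ ∞ (a j) (Icc t₀ t₁))
    (hode : ∀ j, ∀ t ∈ Icc t₀ t₁, derivWithin (x j) (Icc t₀ t₁) t =
      -a j t * x j t + ε j * x (j - 1) t * x j t - δ j * x (j + 1) t ^ 2)
    {Λ : ℕ → ℝ} (hΛ1 : ∀ j, 1 ≤ Λ j) (hΛ : Monotone Λ)
    {κ : ℕ → ℝ} {κbar : ℝ} {M : ℕ} (hκ : ∀ i, i < M → κ i ≤ κbar)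
    (hκbar : 0 ≤ κbar)
    (hα : ∀ j i, ∀ t ∈ Icc t₀ t₁, |iteratedDerivWithin i (a j) (Icc t₀ t₁) t| ≤ κ i * Λ j ^ (i + 1))
    (hε : ∀ j, |ε j| ≤ 1) (hδ : ∀ j, |δ j| ≤ 1) (hB : ∀ j, ∀ t ∈ Icc t₀ t₁, |x j t| ≤ Λ j)
    {k : ℕ} {s θ : ℝ} (hθ : 0 ≤ θ)
    (hsmall : ∀ l, k ≤ l → ∀ t ∈ Icc t₀ t₁, t ≤ s → |x l t| ≤ θ * Λ l) {n : ℕ} (hn : n ≤ M) :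
    (∀ j, ∀ t ∈ Icc t₀ t₁, |iteratedDerivWithin n (x j) (Icc t₀ t₁) t| ≤
        (κbar + 2) ^ n * (n.factorial : ℝ) ^ 2 * Λ (j + n) ^ 3 ^ n) ∧
      ∀ l, k ≤ l → ∀ t ∈ Icc t₀ t₁, t ≤ s → |iteratedDerivWithin n (x l) (Icc t₀ t₁) t| ≤
        θ * ((κbar + 2) ^ n * (n.factorial : ℝ) ^ 2 * Λ (l + n) ^ 3 ^ n) := by
  set G : ℕ → ℕ → ℝ := fun j n => (κbar + 2) ^ n * (n.factorial : ℝ) ^ 2 * Λ (j + n) ^ 3 ^ n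
    with hGdef
  set P : ℝ := κbar + 2 with hP
  have hP1 : 1 ≤ P := by rw [hP]; linarith
  have hΛpos : ∀ q, 0 < Λ q := fun q => zero_lt_one.trans_le (hΛ1 q)
  have hGnn : ∀ j n, 0 ≤ G j n := fun j n => by
    simp only [hGdef]; have := hΛ1 (j + n); positivity
  have hG0 : ∀ j, ∀ t ∈ Icc t₀ t₁, |x j t| ≤ G j 0 := fun j t ht => by
    simpa [hGdef] using hB j t ht
  have hsmall' : ∀ l, k ≤ l → ∀ t ∈ Icc t₀ t₁, t ≤ s → |x l t| ≤ θ * G l 0 :=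
    fun l hl t ht hts => by simpa [hGdef] using hsmall l hl t ht hts
  -- the recursion inequality
  have hrec : ∀ j m, m < M → ∑ i ∈ range (m + 1), (m.choose i : ℝ) *
      (κ i * Λ j ^ (i + 1) * G j (m - i) + |ε j| * G (j - 1) i * G j (m - i) +
        |δ j| * G (j + 1) i * G (j + 1) (m - i)) ≤ G j (m + 1) := by
    intro j m hm
    set W : ℝ := Λ (j + (m + 1)) with hW
    have hW1 : 1 ≤ W := hΛ1 _
    -- every summand is bounded by `C(m,i) (i!(m-i)!)² · P^(m+1) · W^(3^(m+1))`
    have hsum : ∀ i ∈ range (m + 1), (m.choose i : ℝ) *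
        (κ i * Λ j ^ (i + 1) * G j (m - i) + |ε j| * G (j - 1) i * G j (m - i) +
          |δ j| * G (j + 1) i * G (j + 1) (m - i)) ≤
        (m.choose i : ℝ) * ((i.factorial : ℝ) * ((m - i).factorial : ℝ)) ^ 2 *
          (P ^ (m + 1) * W ^ 3 ^ (m + 1)) := by
      intro i hi
      have him : i ≤ m := Nat.lt_succ_iff.1 (mem_range.1 hi)
      have hiM : i < M := lt_of_le_of_lt him hm
      -- the common scale bounds
      have hΛle : ∀ q, q ≤ j + (m + 1) → ∀ e e' : ℕ, e ≤ e' → Λ q ^ e ≤ W ^ e' :=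
        fun q hq e e' he => pow_le_pow_of_le_of_le (hΛ1 q) (hΛ hq) he
      have hPpow : ∀ e, e ≤ m → P ^ e ≤ P ^ m := fun e he => pow_le_pow_right₀ hP1 he
      have hfi : (1 : ℝ) ≤ (i.factorial : ℝ) := by exact_mod_cast Nat.succ_le_of_lt i.factorial_pos
      have hfmi : (1 : ℝ) ≤ ((m - i).factorial : ℝ) := by
        exact_mod_cast Nat.succ_le_of_lt (m - i).factorial_pos
      -- term 1
      have T1 : κ i * Λ j ^ (i + 1) * G j (m - i) ≤
          κbar * (P ^ m * ((i.factorial : ℝ) * ((m - i).factorial : ℝ)) ^ 2 * W ^ 3 ^ (m + 1)) := by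
        simp only [hGdef]
        have h1 : Λ j ^ (i + 1) * Λ (j + (m - i)) ^ 3 ^ (m - i) ≤ W ^ 3 ^ (m + 1) := by
          calc Λ j ^ (i + 1) * Λ (j + (m - i)) ^ 3 ^ (m - i)
              ≤ W ^ (i + 1) * W ^ 3 ^ (m - i) :=
                mul_le_mul (hΛle j (by omega) _ _ le_rfl) (hΛle _ (by omega) _ _ le_rfl)
                  (by have := hΛ1 (j + (m - i)); positivity) (by positivity)
            _ = W ^ (i + 1 + 3 ^ (m - i)) := by rw [← pow_add]
            _ ≤ W ^ 3 ^ (m + 1) := pow_le_pow_right₀ hW1 (exp_bound₁ him)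
        have h2 : ((m - i).factorial : ℝ) ^ 2 ≤ ((i.factorial : ℝ) * ((m - i).factorial : ℝ)) ^ 2 := by
          apply pow_le_pow_left₀ (by positivity)
          nlinarith
        calc κ i * Λ j ^ (i + 1) * (P ^ (m - i) * ((m - i).factorial : ℝ) ^ 2 *
              Λ (j + (m - i)) ^ 3 ^ (m - i))
            = κ i * (P ^ (m - i) * ((m - i).factorial : ℝ) ^ 2 *
                (Λ j ^ (i + 1) * Λ (j + (m - i)) ^ 3 ^ (m - i))) := by ring
          _ ≤ κbar * (P ^ m * ((i.factorial : ℝ) * ((m - i).factorial : ℝ)) ^ 2 * W ^ 3 ^ (m + 1)) := by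
              have hL : 0 ≤ Λ j ^ (i + 1) * Λ (j + (m - i)) ^ 3 ^ (m - i) := by
                have := hΛpos j; have := hΛpos (j + (m - i)); positivity
              refine mul_le_mul (hκ i hiM) ?_ (by positivity) hκbar
              exact mul_le_mul (mul_le_mul (hPpow _ (Nat.sub_le m i)) h2 (by positivity)
                (by positivity)) h1 hL (by positivity)
      -- term 2
      have T2 : |ε j| * G (j - 1) i * G j (m - i) ≤
          1 * (P ^ m * ((i.factorial : ℝ) * ((m - i).factorial : ℝ)) ^ 2 * W ^ 3 ^ (m + 1)) := by
        simp only [hGdef]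
        have h1 : Λ (j - 1 + i) ^ 3 ^ i * Λ (j + (m - i)) ^ 3 ^ (m - i) ≤ W ^ 3 ^ (m + 1) := by
          calc Λ (j - 1 + i) ^ 3 ^ i * Λ (j + (m - i)) ^ 3 ^ (m - i)
              ≤ W ^ 3 ^ i * W ^ 3 ^ (m - i) :=
                mul_le_mul (hΛle _ (by omega) _ _ le_rfl) (hΛle _ (by omega) _ _ le_rfl)
                  (by have := hΛ1 (j + (m - i)); positivity) (by positivity)
            _ = W ^ (3 ^ i + 3 ^ (m - i)) := by rw [← pow_add]
            _ ≤ W ^ 3 ^ (m + 1) := pow_le_pow_right₀ hW1 (exp_bound₂ him)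
        have hPP : P ^ i * P ^ (m - i) = P ^ m := by rw [← pow_add, Nat.add_sub_cancel' him]
        calc |ε j| * (P ^ i * (i.factorial : ℝ) ^ 2 * Λ (j - 1 + i) ^ 3 ^ i) *
              (P ^ (m - i) * ((m - i).factorial : ℝ) ^ 2 * Λ (j + (m - i)) ^ 3 ^ (m - i))
            = |ε j| * ((P ^ i * P ^ (m - i)) * ((i.factorial : ℝ) * ((m - i).factorial : ℝ)) ^ 2 *
                (Λ (j - 1 + i) ^ 3 ^ i * Λ (j + (m - i)) ^ 3 ^ (m - i))) := by ring
          _ ≤ 1 * (P ^ m * ((i.factorial : ℝ) * ((m - i).factorial : ℝ)) ^ 2 * W ^ 3 ^ (m + 1)) := by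
              rw [hPP]
              have hL : 0 ≤ Λ (j - 1 + i) ^ 3 ^ i * Λ (j + (m - i)) ^ 3 ^ (m - i) := by
                have := hΛpos (j - 1 + i); have := hΛpos (j + (m - i)); positivity
              exact mul_le_mul (hε j) (mul_le_mul_of_nonneg_left h1 (by positivity))
                (by positivity) zero_le_one
      -- term 3
      have T3 : |δ j| * G (j + 1) i * G (j + 1) (m - i) ≤
          1 * (P ^ m * ((i.factorial : ℝ) * ((m - i).factorial : ℝ)) ^ 2 * W ^ 3 ^ (m + 1)) := by
        simp only [hGdef]
        have h1 : Λ (j + 1 + i) ^ 3 ^ i * Λ (j + 1 + (m - i)) ^ 3 ^ (m - i) ≤ W ^ 3 ^ (m + 1) := by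
          calc Λ (j + 1 + i) ^ 3 ^ i * Λ (j + 1 + (m - i)) ^ 3 ^ (m - i)
              ≤ W ^ 3 ^ i * W ^ 3 ^ (m - i) :=
                mul_le_mul (hΛle _ (by omega) _ _ le_rfl) (hΛle _ (by omega) _ _ le_rfl)
                  (by have := hΛ1 (j + 1 + (m - i)); positivity) (by positivity)
            _ = W ^ (3 ^ i + 3 ^ (m - i)) := by rw [← pow_add]
            _ ≤ W ^ 3 ^ (m + 1) := pow_le_pow_right₀ hW1 (exp_bound₂ him)
        have hPP : P ^ i * P ^ (m - i) = P ^ m := by rw [← pow_add, Nat.add_sub_cancel' him]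
        calc |δ j| * (P ^ i * (i.factorial : ℝ) ^ 2 * Λ (j + 1 + i) ^ 3 ^ i) *
              (P ^ (m - i) * ((m - i).factorial : ℝ) ^ 2 * Λ (j + 1 + (m - i)) ^ 3 ^ (m - i))
            = |δ j| * ((P ^ i * P ^ (m - i)) * ((i.factorial : ℝ) * ((m - i).factorial : ℝ)) ^ 2 *
                (Λ (j + 1 + i) ^ 3 ^ i * Λ (j + 1 + (m - i)) ^ 3 ^ (m - i))) := by ring
          _ ≤ 1 * (P ^ m * ((i.factorial : ℝ) * ((m - i).factorial : ℝ)) ^ 2 * W ^ 3 ^ (m + 1)) := by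
              rw [hPP]
              have hL : 0 ≤ Λ (j + 1 + i) ^ 3 ^ i * Λ (j + 1 + (m - i)) ^ 3 ^ (m - i) := by
                have := hΛpos (j + 1 + i); have := hΛpos (j + 1 + (m - i)); positivity
              exact mul_le_mul (hδ j) (mul_le_mul_of_nonneg_left h1 (by positivity))
                (by positivity) zero_le_one
      have hsum3 := add_le_add (add_le_add T1 T2) T3
      calc (m.choose i : ℝ) * (κ i * Λ j ^ (i + 1) * G j (m - i) + |ε j| * G (j - 1) i * G j (m - i) +
            |δ j| * G (j + 1) i * G (j + 1) (m - i))
          ≤ (m.choose i : ℝ) * ((κbar + 1 + 1) *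
              (P ^ m * ((i.factorial : ℝ) * ((m - i).factorial : ℝ)) ^ 2 * W ^ 3 ^ (m + 1))) := by
            refine mul_le_mul_of_nonneg_left ?_ (Nat.cast_nonneg _)
            linarith
        _ = (m.choose i : ℝ) * ((i.factorial : ℝ) * ((m - i).factorial : ℝ)) ^ 2 *
              (P ^ (m + 1) * W ^ 3 ^ (m + 1)) := by rw [hP]; ring
    calc ∑ i ∈ range (m + 1), (m.choose i : ℝ) *
          (κ i * Λ j ^ (i + 1) * G j (m - i) + |ε j| * G (j - 1) i * G j (m - i) +
            |δ j| * G (j + 1) i * G (j + 1) (m - i))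
        ≤ ∑ i ∈ range (m + 1), (m.choose i : ℝ) * ((i.factorial : ℝ) * ((m - i).factorial : ℝ)) ^ 2 *
            (P ^ (m + 1) * W ^ 3 ^ (m + 1)) := sum_le_sum hsum
      _ ≤ ∑ i ∈ range (m + 1), (m.factorial : ℝ) ^ 2 * (P ^ (m + 1) * W ^ 3 ^ (m + 1)) := by
          refine sum_le_sum fun i hi => ?_
          exact mul_le_mul_of_nonneg_right
            (choose_mul_factorial_sq_le (Nat.lt_succ_iff.1 (mem_range.1 hi))) (by positivity)
      _ = (m + 1) * (m.factorial : ℝ) ^ 2 * (P ^ (m + 1) * W ^ 3 ^ (m + 1)) := by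
          rw [sum_const, card_range, nsmul_eq_mul]; push_cast; ring
      _ ≤ ((m + 1).factorial : ℝ) ^ 2 * (P ^ (m + 1) * W ^ 3 ^ (m + 1)) := by
          refine mul_le_mul_of_nonneg_right ?_ (by positivity)
          rw [Nat.factorial_succ]; push_cast
          have : (0 : ℝ) ≤ m := Nat.cast_nonneg m
          nlinarith [sq_nonneg ((m.factorial : ℝ))]
      _ = G j (m + 1) := by simp only [hGdef, hW]; ring
  have key := abs_iteratedDerivWithin_le_mul_of_quadraticChain ht₀ hx ha hode hα hG0
    (G := G) hrec hθ hsmall' hn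
  exact ⟨fun j t ht => by simpa [hGdef] using key.1 j t ht,
    fun l hl t ht hts => by simpa [hGdef] using key.2 l hl t ht hts⟩

end QuadraticChain

end Literature.Analysis.ODE
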